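import Summits.HodgeConjecture.HodgeConjecture.Theorems.F0P6aStubEHECKEReaders
import HarnessLib

/-!
# `F0P6aStubEHECKEOrganT` — ★ RE-HOME of `Lines/F0_P6a_StubEHECKE.lean`, PART 3 of 6 (size-lint split; cut at a declaration boundary).

## Import provenance
- `Theorems.F0P6aStubEHECKEReaders` = ★ previous part of the same `Lines` workfile `F0_P6a_StubEHECKE` (size-lint split ×6); `HarnessLib`.

See PART 1 `Theorems/F0P6aStubEHECKESocket.lean` for the full re-home header and the original module docstring (verbatim there). Namespaces and sections KEPT
(re-opened below exactly as they stand at the cut, with their `open`∕`variable` lines replayed); code bytes = the workfile՚s, docstrings included; options preamble repeated from PART 1.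
HC_CM is proved only modulo the 7 printed citations (2 remaining: hLiu418 = stmt-HodgeConjecture-24832, h413 = stmt-HodgeConjecture-24833) until rung 0 closes; a re-home is count-neutral. -/

set_option autoImplicit false

noncomputable section

namespace Summit.HodgeConjecture.HodgeConjecture.Cruxes.HLiu418.F0P6aStubEHECKE
set_option linter.dupNamespace false
open CategoryTheory CategoryTheory.Limits NumberField IsDedekindDomain MulAction AlgebraicGeometry
open scoped Matrix Polynomial Pointwise
open Literature.NumberTheory.GaloisRepresentations
open Literature.NumberTheory.Automorphic Literature.NumberTheory.Automorphic.UnitaryGroup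
open Literature.AlgebraicGeometry.ShimuraVarieties Literature.AlgebraicGeometry.ShimuraVarieties.UnitaryCanonicalModel
open Literature.NumberTheory.Automorphic.Liu2021.AppendixC
open Literature.AlgebraicGeometry.Motives (AlgPoints ComplexPoints SchemeOver thickeningLift specOver)
open Literature.AlgebraicGeometry.Motives.AbelianVariety (bcSpec)
open Literature.AlgebraicGeometry.AbelianSchemes (PolarizedAbelianSchemeWithLevel AbelianSchemeOver)
open Literature.AlgebraicGeometry.ModuliOfAbelianVarieties
open Summit.HodgeConjecture.HodgeConjecture.Cruxes.HLiu418.F0P6aPELWitnessE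
open Summit.HodgeConjecture.HodgeConjecture.Cruxes.HLiu418.F0P6aStubE6 (RingActionReading Reads)
open Summit.HodgeConjecture.HodgeConjecture.Cruxes.HLiu418.F0P6aEReadings (EHeckeAt HeckeRoofsE RoofE schEOf fibreEOf dualEOf polEOf lvlPtEOf actEOf IsIdealTorsionE)
open Literature.AlgebraicGeometry.AbelianSchemes.AbelianSchemeOver (fibreHom RingAction exists_pointsAlong_mulEquiv_of_eq pointsAlong_map_of_eq
  pointsAlong_forall_map_eq_one_iff_of_eq roof_readAt_comp_of_eq)
open Summit.HodgeConjecture.HodgeConjecture.Cruxes.HLiu418.F0P6aModuliDatumDefs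
open Summit.HodgeConjecture.HodgeConjecture.Cruxes.HLiu418.F0P6aRGDAssembly
open Literature.AlgebraicGeometry.Motives (CMType)
open Literature.AlgebraicGeometry.ShimuraVarieties.UnitaryCanonicalModel.Aux (ratBasis torusFinAdelic)
open Literature.AlgebraicGeometry.ShimuraVarieties.UnitaryCurve Literature.AlgebraicGeometry.ShimuraVarieties.UnitaryCurve.AuxV
open Literature.NumberTheory.ComplexMultiplication.CMTypeOps (flip bar)
open Literature.Geometry.Kaehler (ComplexTorus)
open Summit.HodgeConjecture.HodgeConjecture.Cruxes.HLiu418.F0P6aChartFramePin (IsChartOfFrame)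


/-- **ORGAN (O-T) `OrganET` — TRANSPORT `ℂ ↝ F̄_w`.**  For a ring isomorphism `σ : F̄_w ≃+* ℂ` with `σ ∘ e′ = τE` on `Fᵢ`: the Hecke roofs of the tuple `(univ, act, dual, pol, lvl)`
over `X ⊗_F Fᵢ` READ AT THE COMPLEX POINT `σ_* x′` ON THE SHEET `τE♯` imply the Hecke roofs READ AT THE `F̄_w`-POINT `x′` ON THE SHEET `e′` (same `N′`, `rc₁`, `rc₂`).
Mechanism (all ★): the sheet points move by `ℓ_{σ∘e′}(σ_* y) = Spec σ ≫ ℓ_{e′}(y)` (★ `thickeningLift_mk_specMap_comp_left`, with `σ♯ ∘ e′ = τE♯` as `F`-algebra maps);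
fibres ∕ duals ∕ polarisations ∕ actions ∕ level points along an iso of bases by ★ `tupleRel_baseChangeCompGrpIso_inv`; point groups by the bijection ★ p849519 §1
`pointsTransfer_*` (`MulEquiv.ofBijective`); each roof by ★ p849602 ∕ ★ `roof_baseChange_of_isIso` + ★ `roof_transport_along_iso`; the lines (a)(b)(c) by ★
`HeckeLines.lines_transport`; torsion ∕ stability predicates by ★ `forall_map_eq_one_iff_of_iso`.  By copy of E-READINGS §3 `heckeRoofsAt_of_E` with `Spec σ` for the
tuple iso.  Offered BY NAME → B-p08 (g34) (L5-#5); a genuine lemma (size M).  NOT asserted by declaring it. (print: GortzWedhorn2020, Section (4.8)–(4.9))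
(print: MumfordAV1970, §23 Thm. 2 p. 231) (print: HarrisTaylorAMS2001, §III.4, pp. 108–110) -/
def OrganET : Prop :=
  ∀ (F : Type) [Field F] [NumberField F] [IsCMField F] (ι₁ : F →+* ℂ)
    (Jstar : Matrix (Fin 2) (Fin 2) F) (hJ : (Jstar.map (IsCMField.complexConj F))ᵀ = Jstar) (hJu : IsUnit Jstar)
    (K₀ : C5.OpenCompactSubgroup (GSAdele F Jstar)) (S : RecordSystemGS F Jstar ι₁ K₀) (hU7ₛ : S.HeckeTranslateDefinedOver) (Kc : C5.SmallLevel K₀)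
    (Fi : Type) [Field Fi] [NumberField Fi] [Algebra F Fi] (τE : Fi →+* ℂ) (hτE : τE.comp (algebraMap F Fi) = ι₁)
    (univ : Literature.AlgebraicGeometry.AbelianSchemes.AbelianSchemeOver ((Literature.AlgebraicGeometry.Motives.baseChange F Fi).obj (S.M.obj Kc)).left)
    (act : Literature.AlgebraicGeometry.AbelianSchemes.AbelianSchemeOver.RingAction (𝓞 F) univ)
    (dual : univ.DualPair) (pol : univ.Polarization dual) {g N : ℕ} (lvl : univ.LevelStructure g N)
    (w : HeightOneSpectrum (𝓞 F)) (hw : (IsCMField.complexConj F) • w ≠ w) (pChar fDeg : ℕ)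
    (σ : AlgebraicClosure (w.adicCompletion F) ≃+* ℂ) (e' : Fi →ₐ[F] AlgebraicClosure (w.adicCompletion F)) (hσe : ∀ x : Fi, σ (e' x) = τE x)
    (N' : C5.SmallLevel K₀) (hN'Kc : N' ≤ Kc)
    (rc₁ : orbit (Kc.1.1 : Subgroup ↥(finAdelic ↥(maximalRealSubfield F) F (IsCMField.complexConj F) 2 Jstar))
         ((UnitaryGroup.heckeElementAt ↥(maximalRealSubfield F) F (IsCMField.complexConj F) 2 Jstar
             (⟨w, rfl⟩ : UnitaryGroup.PlacesOver F (w.under (𝓞 ↥(maximalRealSubfield F))))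
             (IsCMField.complexConj_ne_one F) hJ hw (UnitaryGroup.isUnit_placeForm Jstar hJu w) (HeckeCharacter.uniformizer F w) 1 :
           ↥(finAdelic ↥(maximalRealSubfield F) F (IsCMField.complexConj F) 2 Jstar)) :
           ↥(finAdelic ↥(maximalRealSubfield F) F (IsCMField.complexConj F) 2 Jstar) ⧸
             (Kc.1.1 : Subgroup ↥(finAdelic ↥(maximalRealSubfield F) F (IsCMField.complexConj F) 2 Jstar))) →
       ↥(finAdelic ↥(maximalRealSubfield F) F (IsCMField.complexConj F) 2 Jstar))
    (hrcN₁ : ∀ β, C5.HeckeLE (rc₁ β) N' Kc)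
    (rc₂ : orbit (Kc.1.1 : Subgroup ↥(finAdelic ↥(maximalRealSubfield F) F (IsCMField.complexConj F) 2 Jstar))
         ((UnitaryGroup.heckeElementAt ↥(maximalRealSubfield F) F (IsCMField.complexConj F) 2 Jstar
             (⟨w, rfl⟩ : UnitaryGroup.PlacesOver F (w.under (𝓞 ↥(maximalRealSubfield F))))
             (IsCMField.complexConj_ne_one F) hJ hw (UnitaryGroup.isUnit_placeForm Jstar hJu w) (HeckeCharacter.uniformizer F w) 2 :
           ↥(finAdelic ↥(maximalRealSubfield F) F (IsCMField.complexConj F) 2 Jstar)) :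
           ↥(finAdelic ↥(maximalRealSubfield F) F (IsCMField.complexConj F) 2 Jstar) ⧸
             (Kc.1.1 : Subgroup ↥(finAdelic ↥(maximalRealSubfield F) F (IsCMField.complexConj F) 2 Jstar))) →
       ↥(finAdelic ↥(maximalRealSubfield F) F (IsCMField.complexConj F) 2 Jstar))
    (hrcN₂ : ∀ β, C5.HeckeLE (rc₂ β) N' Kc)
    (x' : AlgPoints (S.M.obj N') (AlgebraicClosure (w.adicCompletion F))),
    (letI : Algebra F ℂ := ι₁.toAlgebra
     HeckeRoofsAt S hU7ₛ hJ hJu Kc w hw univ act dual pol lvl pChar fDeg (sheetHom ι₁ τE hτE) N' hN'Kc rc₁ hrcN₁ rc₂ hrcN₂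
       (movePt (sigmaHom ι₁ τE hτE w σ e' hσe) (S.M.obj N') x')) →
    HeckeRoofsAt S hU7ₛ hJ hJu Kc w hw univ act dual pol lvl pChar fDeg e' N' hN'Kc rc₁ hrcN₁ rc₂ hrcN₂ x'

/-! #### (O-T) ORGAN BODY — B-p08 (g34), L5-#5 (LA5-plan (g3) 05:49:43Z).  Add-only: three generic `subst` wrappers of ★ p849602 (target sheet-point
morphism generalised to a variable `m` with `x ≫ ℓ = m`, so that the transported readings land LITERALLY at `ℓ_{e′} y` — squad doctrine (F7): generalise + `subst`,
no `▸`), one pin-at-points variant of ★ `roof_readAt_comp` (the family base `X ⊗_F Fᵢ` carries no `IsReduced` instance, the four Poincaré pins are taken at the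
field points from the base-changed polarisations), then `stub_ET`. -/

-- (O-T.1)–(O-T.4) `exists_pointsAlong_mulEquiv_of_eq` ∕ `pointsAlong_map_of_eq` ∕ `pointsAlong_forall_map_eq_one_iff_of_eq` ∕ `roof_readAt_comp_of_eq`
-- now live in ★ p850116 `Literature/AlgebraicGeometry/AbelianSchemes/IsogenyRoofAlongPointBaseChangeOfEq.lean` (B-p08 (g34), 2026-09-02 07:14Z) — imported, `open`ed at the top.

set_option maxHeartbeats 400000 in
/-- (O-T.5) **ONE ROOF MOVES ALONG AN ISOMORPHISM OF POINT BASES**, in the currency of the §1 readers: if `x ≫ ℓ_{e₁}(y) = ℓ_{e₂}(z)` and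
`x ≫ ℓ_{e₁}(y″) = ℓ_{e₂}(z″)` for an isomorphism `x : Spec Ω′ ⟶ Spec Ω`, then `RoofAt … e₁ … y y″ K → RoofAt … e₂ … z z″ K′` for `K′` threaded through a
transfer `Φ` of fibre points ((O-T.4) after unfolding the readers; pins from the base-changed polarisations over the reduced bases `Spec Ω`, `Spec Ω′`).
[cite: MumfordFogartyKirwan1994, Ch. 7 §2 Definition 7.2 (p. 129)] [cite: GortzWedhorn2020, Section (4.7) (pp. 107–108) and Prop. 4.16 (p. 101)] -/
theorem roofAt_transport {F : Type} [Field F] [NumberField F] [IsCMField F] {ι₁ : F →+* ℂ} {Jstar : Matrix (Fin 2) (Fin 2) F}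
    {K₀ : C5.OpenCompactSubgroup ↥(finAdelic ↥(maximalRealSubfield F) F (IsCMField.complexConj F) 2 Jstar)}
    (S : RecordSystemGS F Jstar ι₁ K₀) {Fi : Type} [Field Fi] [Algebra F Fi] (Kc : C5.SmallLevel K₀)
    {Ω Ω' : Type} [Field Ω] [Algebra F Ω] [Field Ω'] [Algebra F Ω'] [IsReduced (Spec (CommRingCat.of Ω))] [IsReduced (Spec (CommRingCat.of Ω'))]
    (e₁ : Fi →ₐ[F] Ω) (e₂ : Fi →ₐ[F] Ω')
    (𝒜 : Literature.AlgebraicGeometry.AbelianSchemes.AbelianSchemeOver ((Literature.AlgebraicGeometry.Motives.baseChange F Fi).obj (S.M.obj Kc)).left)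
    (ρ : Literature.AlgebraicGeometry.AbelianSchemes.AbelianSchemeOver.RingAction (𝓞 F) 𝒜)
    (D : 𝒜.DualPair) (pol : 𝒜.Polarization D) {g N : ℕ} (lvl : 𝒜.LevelStructure g N) (pChar : ℕ) (𝔞 : Ideal (𝓞 F))
    (x : Spec (CommRingCat.of Ω') ⟶ Spec (CommRingCat.of Ω)) [IsIso x]
    (y y'' : AlgPoints (S.M.obj Kc) Ω) (z z'' : AlgPoints (S.M.obj Kc) Ω')
    (h : x ≫ (thickeningLift e₁ (S.M.obj Kc) y).left = (thickeningLift e₂ (S.M.obj Kc) z).left)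
    (h'' : x ≫ (thickeningLift e₁ (S.M.obj Kc) y'').left = (thickeningLift e₂ (S.M.obj Kc) z'').left)
    {Φ : (fibreAt S Kc e₁ 𝒜 y).Points Ω → (fibreAt S Kc e₂ 𝒜 z).Points Ω'}
    (hΦ : ∀ P, (Φ P).left ≫ pullback.fst 𝒜.X.hom (thickeningLift e₂ (S.M.obj Kc) z).left =
      x ≫ P.left ≫ pullback.fst 𝒜.X.hom (thickeningLift e₁ (S.M.obj Kc) y).left)
    (K : Subgroup ((fibreAt S Kc e₁ 𝒜 y).Points Ω)) (K' : Subgroup ((fibreAt S Kc e₂ 𝒜 z).Points Ω')) (hK : ∀ P, Φ P ∈ K' ↔ P ∈ K)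
    (hr : RoofAt S Kc e₁ 𝒜 ρ D pol lvl pChar 𝔞 y y'' K) : RoofAt S Kc e₂ 𝒜 ρ D pol lvl pChar 𝔞 z z'' K' := by
  have p₁ := (polAt S Kc e₁ 𝒜 pol y).nonempty_unitHatSlice_iso
  have p₂ := (polAt S Kc e₁ 𝒜 pol y'').nonempty_unitHatSlice_iso
  have p₃ := (polAt S Kc e₂ 𝒜 pol z).nonempty_unitHatSlice_iso
  have p₄ := (polAt S Kc e₂ 𝒜 pol z'').nonempty_unitHatSlice_iso
  dsimp only [RoofAt, IsIdealTorsionAt, actAt, lvlPtAt, Literature.AlgebraicGeometry.AbelianSchemes.AbelianSchemeOver.fibre,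
    Literature.AlgebraicGeometry.AbelianSchemes.AbelianSchemeOver.fibreHom_hom_hom_hom] at hr ⊢
  exact roof_readAt_comp_of_eq 𝒜 ρ D pol lvl _ _ x _ _ h h'' p₁ p₂ p₃ p₄ (· ∈ 𝔞) pChar K K' hΦ hK hr

/-- (O-T.6) THE TRANSFER OF FIBRE POINTS in the currency of the §1 readers ((O-T.1) on the nose: `fibreAt … y = (𝒜 ×_X ℓ_e(y)).toAffine.toAbelianVariety`).
[cite: GortzWedhorn2020, Section (4.7) (pp. 107–108)] -/
theorem exists_transfer_fibreAt {F : Type} [Field F] [NumberField F] [IsCMField F] {ι₁ : F →+* ℂ} {Jstar : Matrix (Fin 2) (Fin 2) F}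
    {K₀ : C5.OpenCompactSubgroup ↥(finAdelic ↥(maximalRealSubfield F) F (IsCMField.complexConj F) 2 Jstar)}
    (S : RecordSystemGS F Jstar ι₁ K₀) {Fi : Type} [Field Fi] [Algebra F Fi] (Kc : C5.SmallLevel K₀)
    {Ω Ω' : Type} [Field Ω] [Algebra F Ω] [Field Ω'] [Algebra F Ω'] (e₁ : Fi →ₐ[F] Ω) (e₂ : Fi →ₐ[F] Ω')
    (𝒜 : Literature.AlgebraicGeometry.AbelianSchemes.AbelianSchemeOver ((Literature.AlgebraicGeometry.Motives.baseChange F Fi).obj (S.M.obj Kc)).left)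
    (x : Spec (CommRingCat.of Ω') ⟶ Spec (CommRingCat.of Ω)) [IsIso x]
    (y : AlgPoints (S.M.obj Kc) Ω) (z : AlgPoints (S.M.obj Kc) Ω')
    (h : x ≫ (thickeningLift e₁ (S.M.obj Kc) y).left = (thickeningLift e₂ (S.M.obj Kc) z).left) :
    ∃ Φ : (fibreAt S Kc e₁ 𝒜 y).Points Ω ≃* (fibreAt S Kc e₂ 𝒜 z).Points Ω',
      ∀ P, (Φ P).left ≫ pullback.fst 𝒜.X.hom (thickeningLift e₂ (S.M.obj Kc) z).left =
        x ≫ P.left ≫ pullback.fst 𝒜.X.hom (thickeningLift e₁ (S.M.obj Kc) y).left :=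
  exists_pointsAlong_mulEquiv_of_eq 𝒜 _ x _ h

/-- (O-T.7) IDEAL TORSION IS DETECTED BY THE TRANSFER, reader currency ((O-T.3)). [cite: MumfordFogartyKirwan1994, Ch. 6 §1 Corollary 6.4 (p. 117)] -/
theorem transfer_isIdealTorsionAt_iff {F : Type} [Field F] [NumberField F] [IsCMField F] {ι₁ : F →+* ℂ} {Jstar : Matrix (Fin 2) (Fin 2) F}
    {K₀ : C5.OpenCompactSubgroup ↥(finAdelic ↥(maximalRealSubfield F) F (IsCMField.complexConj F) 2 Jstar)}
    (S : RecordSystemGS F Jstar ι₁ K₀) {Fi : Type} [Field Fi] [Algebra F Fi] (Kc : C5.SmallLevel K₀)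
    {Ω Ω' : Type} [Field Ω] [Algebra F Ω] [Field Ω'] [Algebra F Ω'] (e₁ : Fi →ₐ[F] Ω) (e₂ : Fi →ₐ[F] Ω')
    (𝒜 : Literature.AlgebraicGeometry.AbelianSchemes.AbelianSchemeOver ((Literature.AlgebraicGeometry.Motives.baseChange F Fi).obj (S.M.obj Kc)).left)
    (ρ : Literature.AlgebraicGeometry.AbelianSchemes.AbelianSchemeOver.RingAction (𝓞 F) 𝒜)
    (x : Spec (CommRingCat.of Ω') ⟶ Spec (CommRingCat.of Ω)) [IsIso x]
    (y : AlgPoints (S.M.obj Kc) Ω) (z : AlgPoints (S.M.obj Kc) Ω')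
    (h : x ≫ (thickeningLift e₁ (S.M.obj Kc) y).left = (thickeningLift e₂ (S.M.obj Kc) z).left)
    {Φ : (fibreAt S Kc e₁ 𝒜 y).Points Ω → (fibreAt S Kc e₂ 𝒜 z).Points Ω'}
    (hΦ : ∀ P, (Φ P).left ≫ pullback.fst 𝒜.X.hom (thickeningLift e₂ (S.M.obj Kc) z).left =
      x ≫ P.left ≫ pullback.fst 𝒜.X.hom (thickeningLift e₁ (S.M.obj Kc) y).left)
    (𝔡 : Ideal (𝓞 F)) (P : (fibreAt S Kc e₁ 𝒜 y).Points Ω) :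
    IsIdealTorsionAt S Kc e₂ 𝒜 ρ z 𝔡 (Φ P) ↔ IsIdealTorsionAt S Kc e₁ 𝒜 ρ y 𝔡 P := by
  dsimp only [IsIdealTorsionAt, actAt, Literature.AlgebraicGeometry.AbelianSchemes.AbelianSchemeOver.fibre,
    Literature.AlgebraicGeometry.AbelianSchemes.AbelianSchemeOver.fibreHom_hom_hom_hom]
  exact pointsAlong_forall_map_eq_one_iff_of_eq 𝒜 _ x _ h hΦ (· ∈ 𝔡) ρ.i P

/-- (O-T.8) THE TRANSFER IS `𝒪_F`-EQUIVARIANT, reader currency ((O-T.2)). [cite: MumfordFogartyKirwan1994, Ch. 6 §1 Corollary 6.4 (p. 117)] -/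
theorem transfer_actAt {F : Type} [Field F] [NumberField F] [IsCMField F] {ι₁ : F →+* ℂ} {Jstar : Matrix (Fin 2) (Fin 2) F}
    {K₀ : C5.OpenCompactSubgroup ↥(finAdelic ↥(maximalRealSubfield F) F (IsCMField.complexConj F) 2 Jstar)}
    (S : RecordSystemGS F Jstar ι₁ K₀) {Fi : Type} [Field Fi] [Algebra F Fi] (Kc : C5.SmallLevel K₀)
    {Ω Ω' : Type} [Field Ω] [Algebra F Ω] [Field Ω'] [Algebra F Ω'] (e₁ : Fi →ₐ[F] Ω) (e₂ : Fi →ₐ[F] Ω')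
    (𝒜 : Literature.AlgebraicGeometry.AbelianSchemes.AbelianSchemeOver ((Literature.AlgebraicGeometry.Motives.baseChange F Fi).obj (S.M.obj Kc)).left)
    (ρ : Literature.AlgebraicGeometry.AbelianSchemes.AbelianSchemeOver.RingAction (𝓞 F) 𝒜)
    (x : Spec (CommRingCat.of Ω') ⟶ Spec (CommRingCat.of Ω))
    (y : AlgPoints (S.M.obj Kc) Ω) (z : AlgPoints (S.M.obj Kc) Ω')
    (h : x ≫ (thickeningLift e₁ (S.M.obj Kc) y).left = (thickeningLift e₂ (S.M.obj Kc) z).left)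
    {Φ : (fibreAt S Kc e₁ 𝒜 y).Points Ω → (fibreAt S Kc e₂ 𝒜 z).Points Ω'}
    (hΦ : ∀ P, (Φ P).left ≫ pullback.fst 𝒜.X.hom (thickeningLift e₂ (S.M.obj Kc) z).left =
      x ≫ P.left ≫ pullback.fst 𝒜.X.hom (thickeningLift e₁ (S.M.obj Kc) y).left)
    (a : 𝓞 F) (P : (fibreAt S Kc e₁ 𝒜 y).Points Ω) :
    (AlgPoints.map (actAt S Kc e₂ 𝒜 ρ a z).hom.hom.hom (Φ P) : (fibreAt S Kc e₂ 𝒜 z).Points Ω') =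
      Φ (AlgPoints.map (actAt S Kc e₁ 𝒜 ρ a y).hom.hom.hom P) := by
  dsimp only [actAt, Literature.AlgebraicGeometry.AbelianSchemes.AbelianSchemeOver.fibre,
    Literature.AlgebraicGeometry.AbelianSchemes.AbelianSchemeOver.fibreHom_hom_hom_hom]
  exact (pointsAlong_map_of_eq 𝒜 _ x _ h hΦ (ρ.i a) P).symm

set_option maxHeartbeats 400000 in
/-- (O-T.9) **ONE `t₁`-LINE MOVES**: the rider `P ∈ H ↔ P ∈ K ∧ P` is `𝔠`-torsion and the roof through `K` pass along the transfer `Φ` ((O-T.5) + ★ `mem_map_iff_of_iff_and`).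
[cite: MumfordAV1970, §23 Thm. 2 p. 231] [cite: Kottwitz1992, §5, p. 391] -/
theorem lineRoofAt_transport {F : Type} [Field F] [NumberField F] [IsCMField F] {ι₁ : F →+* ℂ} {Jstar : Matrix (Fin 2) (Fin 2) F}
    {K₀ : C5.OpenCompactSubgroup ↥(finAdelic ↥(maximalRealSubfield F) F (IsCMField.complexConj F) 2 Jstar)}
    (S : RecordSystemGS F Jstar ι₁ K₀) {Fi : Type} [Field Fi] [Algebra F Fi] (Kc : C5.SmallLevel K₀)
    {Ω Ω' : Type} [Field Ω] [Algebra F Ω] [Field Ω'] [Algebra F Ω'] [IsReduced (Spec (CommRingCat.of Ω))] [IsReduced (Spec (CommRingCat.of Ω'))]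
    (e₁ : Fi →ₐ[F] Ω) (e₂ : Fi →ₐ[F] Ω')
    (𝒜 : Literature.AlgebraicGeometry.AbelianSchemes.AbelianSchemeOver ((Literature.AlgebraicGeometry.Motives.baseChange F Fi).obj (S.M.obj Kc)).left)
    (ρ : Literature.AlgebraicGeometry.AbelianSchemes.AbelianSchemeOver.RingAction (𝓞 F) 𝒜)
    (D : 𝒜.DualPair) (pol : 𝒜.Polarization D) {g N : ℕ} (lvl : 𝒜.LevelStructure g N) (pChar : ℕ) (𝔠 𝔞 : Ideal (𝓞 F))
    (x : Spec (CommRingCat.of Ω') ⟶ Spec (CommRingCat.of Ω)) [IsIso x]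
    (y y'' : AlgPoints (S.M.obj Kc) Ω) (z z'' : AlgPoints (S.M.obj Kc) Ω')
    (h : x ≫ (thickeningLift e₁ (S.M.obj Kc) y).left = (thickeningLift e₂ (S.M.obj Kc) z).left)
    (h'' : x ≫ (thickeningLift e₁ (S.M.obj Kc) y'').left = (thickeningLift e₂ (S.M.obj Kc) z'').left)
    (Φ : (fibreAt S Kc e₁ 𝒜 y).Points Ω ≃* (fibreAt S Kc e₂ 𝒜 z).Points Ω')
    (hΦ : ∀ P, (Φ P).left ≫ pullback.fst 𝒜.X.hom (thickeningLift e₂ (S.M.obj Kc) z).left =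
      x ≫ P.left ≫ pullback.fst 𝒜.X.hom (thickeningLift e₁ (S.M.obj Kc) y).left)
    (htors : ∀ P, IsIdealTorsionAt S Kc e₂ 𝒜 ρ z 𝔠 (Φ P) ↔ IsIdealTorsionAt S Kc e₁ 𝒜 ρ y 𝔠 P)
    (H K : Subgroup ((fibreAt S Kc e₁ 𝒜 y).Points Ω)) (hK : ∀ P, P ∈ H ↔ P ∈ K ∧ IsIdealTorsionAt S Kc e₁ 𝒜 ρ y 𝔠 P)
    (hr : RoofAt S Kc e₁ 𝒜 ρ D pol lvl pChar 𝔞 y y'' K) :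
    ∃ K' : Subgroup ((fibreAt S Kc e₂ 𝒜 z).Points Ω'),
      (∀ P, P ∈ H.map Φ.toMonoidHom ↔ P ∈ K' ∧ IsIdealTorsionAt S Kc e₂ 𝒜 ρ z 𝔠 P) ∧ RoofAt S Kc e₂ 𝒜 ρ D pol lvl pChar 𝔞 z z'' K' :=
  ⟨K.map Φ.toMonoidHom,
    fun P => Literature.AlgebraicGeometry.AbelianSchemes.HeckeLines.mem_map_iff_of_iff_and Φ _ _ htors H K hK P,
    roofAt_transport S Kc e₁ e₂ 𝒜 ρ D pol lvl pChar 𝔞 x y y'' z z'' h h'' hΦ K (K.map Φ.toMonoidHom)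
      (fun P => by rw [Subgroup.mem_map_equiv, MulEquiv.symm_apply_apply]) hr⟩

set_option maxHeartbeats 400000 in
/-- (O-T.10) **THE CENTRAL ROOF MOVES**: the rider `P ∈ K ↔ P` is `𝔠`-torsion and the roof through `K` pass along `Φ` ((O-T.5)).
[cite: MumfordAV1970, §23 Thm. 2 p. 231] [cite: Kottwitz1992, §5, p. 391] -/
theorem centralRoofAt_transport {F : Type} [Field F] [NumberField F] [IsCMField F] {ι₁ : F →+* ℂ} {Jstar : Matrix (Fin 2) (Fin 2) F}
    {K₀ : C5.OpenCompactSubgroup ↥(finAdelic ↥(maximalRealSubfield F) F (IsCMField.complexConj F) 2 Jstar)}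
    (S : RecordSystemGS F Jstar ι₁ K₀) {Fi : Type} [Field Fi] [Algebra F Fi] (Kc : C5.SmallLevel K₀)
    {Ω Ω' : Type} [Field Ω] [Algebra F Ω] [Field Ω'] [Algebra F Ω'] [IsReduced (Spec (CommRingCat.of Ω))] [IsReduced (Spec (CommRingCat.of Ω'))]
    (e₁ : Fi →ₐ[F] Ω) (e₂ : Fi →ₐ[F] Ω')
    (𝒜 : Literature.AlgebraicGeometry.AbelianSchemes.AbelianSchemeOver ((Literature.AlgebraicGeometry.Motives.baseChange F Fi).obj (S.M.obj Kc)).left)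
    (ρ : Literature.AlgebraicGeometry.AbelianSchemes.AbelianSchemeOver.RingAction (𝓞 F) 𝒜)
    (D : 𝒜.DualPair) (pol : 𝒜.Polarization D) {g N : ℕ} (lvl : 𝒜.LevelStructure g N) (pChar : ℕ) (𝔠 𝔞 : Ideal (𝓞 F))
    (x : Spec (CommRingCat.of Ω') ⟶ Spec (CommRingCat.of Ω)) [IsIso x]
    (y y'' : AlgPoints (S.M.obj Kc) Ω) (z z'' : AlgPoints (S.M.obj Kc) Ω')
    (h : x ≫ (thickeningLift e₁ (S.M.obj Kc) y).left = (thickeningLift e₂ (S.M.obj Kc) z).left)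
    (h'' : x ≫ (thickeningLift e₁ (S.M.obj Kc) y'').left = (thickeningLift e₂ (S.M.obj Kc) z'').left)
    (Φ : (fibreAt S Kc e₁ 𝒜 y).Points Ω ≃* (fibreAt S Kc e₂ 𝒜 z).Points Ω')
    (hΦ : ∀ P, (Φ P).left ≫ pullback.fst 𝒜.X.hom (thickeningLift e₂ (S.M.obj Kc) z).left =
      x ≫ P.left ≫ pullback.fst 𝒜.X.hom (thickeningLift e₁ (S.M.obj Kc) y).left)
    (htors : ∀ P, IsIdealTorsionAt S Kc e₂ 𝒜 ρ z 𝔠 (Φ P) ↔ IsIdealTorsionAt S Kc e₁ 𝒜 ρ y 𝔠 P)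
    (K : Subgroup ((fibreAt S Kc e₁ 𝒜 y).Points Ω)) (hK : ∀ P, P ∈ K ↔ IsIdealTorsionAt S Kc e₁ 𝒜 ρ y 𝔠 P)
    (hr : RoofAt S Kc e₁ 𝒜 ρ D pol lvl pChar 𝔞 y y'' K) :
    ∃ K' : Subgroup ((fibreAt S Kc e₂ 𝒜 z).Points Ω'),
      (∀ P, P ∈ K' ↔ IsIdealTorsionAt S Kc e₂ 𝒜 ρ z 𝔠 P) ∧ RoofAt S Kc e₂ 𝒜 ρ D pol lvl pChar 𝔞 z z'' K' :=
  ⟨K.map Φ.toMonoidHom,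
    fun P => by rw [Subgroup.mem_map_equiv, hK, ← htors (Φ.symm P), MulEquiv.apply_symm_apply],
    roofAt_transport S Kc e₁ e₂ 𝒜 ρ D pol lvl pChar 𝔞 x y y'' z z'' h h'' hΦ K (K.map Φ.toMonoidHom)
      (fun P => by rw [Subgroup.mem_map_equiv, MulEquiv.symm_apply_apply]) hr⟩

set_option maxHeartbeats 400000 in
/-- ORGAN STUB (O-T) — see `OrganET`.  Dealt BY NAME (L5-#5 → B-p08 (g34), else LA4-p01 (g2) after (S5)); the body replaces this `sorry` add-only. -/
theorem stub_ET : OrganET := by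
  -- (O-T) BODY (B-p08 (g34)): sheet `τE♯ = σ♯ ∘ e′`; sheet points of the moved datum are `Spec σ ≫ ℓ_{e′}(·)` (★ `thickeningLift_left_eq_comp_of_left_eq`),
  -- so with `xσ := Spec σ⁻¹` the complex readings sit at `ℓ` with `xσ ≫ ℓ = ℓ_{e′}(·)`; THE transfer `Φ` (O-T.1) carries torsion (O-T.3) and the action
  -- (O-T.2), hence the lines (★ `HeckeLines.lines_transport`, rider ★ `mem_map_iff_of_iff_and`), and every roof moves by (O-T.5).
  intro F _ _ _ ι₁ Jstar hJ hJu K₀ S hU7ₛ Kc Fi _ _ _ τE hτE univ act dual pol g N lvl w hw pChar fDeg σ e' hσe N' hN'Kc rc₁ hrcN₁ rc₂ hrcN₂ x' h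
  letI : Algebra F ℂ := ι₁.toAlgebra
  -- the sheet: `τE♯ = σ♯ ∘ e′`
  have hτ : sheetHom ι₁ τE hτE = (sigmaHom ι₁ τE hτE w σ e' hσe).comp e' := by
    apply AlgHom.ext
    intro z
    exact (hσe z).symm
  rw [hτ] at h
  -- abbreviations: the moved complex point `xC := σ_* x′` and the base isomorphism `xσ := Spec σ⁻¹ : Spec F̄_w ⟶ Spec ℂ`
  set xC := movePt (sigmaHom ι₁ τE hτE w σ e' hσe) (S.M.obj N') x' with hxC
  set xσ : Spec (CommRingCat.of (AlgebraicClosure (w.adicCompletion F))) ⟶ Spec (CommRingCat.of ℂ) :=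
    Spec.map (σ.symm.toCommRingCatIso).hom with hxσ
  haveI hredC : IsReduced (Spec (CommRingCat.of ℂ)) := inferInstance
  haveI hredW : IsReduced (Spec (CommRingCat.of (AlgebraicClosure (w.adicCompletion F)))) := inferInstance
  have hx : xσ ≫ Spec.map (CommRingCat.ofHom (sigmaHom ι₁ τE hτE w σ e' hσe).toRingHom) = 𝟙 _ := by
    rw [hxσ, ← Spec.map_comp, ← Spec.map_id]
    congr 1
    ext z
    exact σ.symm_apply_apply z
  -- the sheet points move: `Spec σ⁻¹ ≫ ℓ_{σ♯∘e′}(f (σ_* x′)) = ℓ_{e′}(f x′)` for every `f : X_{N′} → Z`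
  have hℓ : ∀ (Z : SchemeOver F) (f : S.M.obj N' ⟶ Z),
      xσ ≫ (thickeningLift ((sigmaHom ι₁ τE hτE w σ e' hσe).comp e') Z (AlgPoints.map f xC)).left =
        (thickeningLift e' Z (AlgPoints.map f x')).left := by
    intro Z f
    rw [Literature.AlgebraicGeometry.Motives.thickeningLift_left_eq_comp_of_left_eq e' (sigmaHom ι₁ τE hτE w σ e' hσe) Z
      (AlgPoints.map f x') (AlgPoints.map f xC)
      (by rw [hxC, AlgPoints.map_apply, AlgPoints.map_apply, Over.comp_left, Over.comp_left]; exact Category.assoc _ _ _),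
      ← Category.assoc, hx, Category.id_comp]
  -- unfold the complex readings
  obtain ⟨Hβ, hinj, hlines, hexh, hr₁, hr₂⟩ := h
  have h₀ := hℓ _ (S.M.map (homOfLE hN'Kc))
  -- THE transfer of fibre points at the base point ((O-T.6)); torsion and action correspond ((O-T.7)/(O-T.8))
  obtain ⟨Φ, hΦ⟩ := exists_transfer_fibreAt S Kc ((sigmaHom ι₁ τE hτE w σ e' hσe).comp e') e' univ xσ
    (AlgPoints.map (S.M.map (homOfLE hN'Kc)) xC) (AlgPoints.map (S.M.map (homOfLE hN'Kc)) x') h₀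
  have htors := fun (𝔡 : Ideal (𝓞 F)) P =>
    transfer_isIdealTorsionAt_iff S Kc ((sigmaHom ι₁ τE hτE w σ e' hσe).comp e') e' univ act xσ _ _ h₀ hΦ 𝔡 P
  have hactΦ := fun (a : 𝓞 F) P =>
    transfer_actAt S Kc ((sigmaHom ι₁ τE hτE w σ e' hσe).comp e') e' univ act xσ _ _ h₀ hΦ a P
  -- (a)(b)(c) THE LINES along `Φ`
  have hL := Literature.AlgebraicGeometry.AbelianSchemes.HeckeLines.lines_transport Φ
    (IsIdealTorsionAt S Kc ((sigmaHom ι₁ τE hτE w σ e' hσe).comp e') univ act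
      (AlgPoints.map (S.M.map (homOfLE hN'Kc)) xC) ((IsCMField.complexConj F) • w).asIdeal)
    (IsIdealTorsionAt S Kc e' univ act (AlgPoints.map (S.M.map (homOfLE hN'Kc)) x') ((IsCMField.complexConj F) • w).asIdeal)
    (fun a P => AlgPoints.map (actAt S Kc ((sigmaHom ι₁ τE hτE w σ e' hσe).comp e') univ act a
      (AlgPoints.map (S.M.map (homOfLE hN'Kc)) xC)).hom.hom.hom P)
    (fun a Q => AlgPoints.map (actAt S Kc e' univ act a (AlgPoints.map (S.M.map (homOfLE hN'Kc)) x')).hom.hom.hom Q)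
    (htors _) hactΦ Hβ hinj hlines hexh
  -- (d)(e) THE ROOFS by (O-T.5), and assembly
  refine ⟨fun β => (Hβ β).map Φ.toMonoidHom, hL.1, hL.2.1, hL.2.2, fun β => ?_, fun β₂ => ?_⟩
  -- CURRENCY OF THE ROOF READINGS (heartbeat cure (H1), LA7-plan (g10) 2026-09-03): eliminate the two `∃ K, rider ∧ RoofAt` readings by `Exists.elim` in
  -- term mode — the `obtain` destructuring of `hr₁ β` ∕ `hr₂ β₂` against the transported goal measured 91 150 + 34 757 of the 358 003 heartbeats
  · exact (hr₁ β).elim fun Kβ hK =>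
      lineRoofAt_transport S Kc ((sigmaHom ι₁ τE hτE w σ e' hσe).comp e') e' univ act dual pol lvl pChar
      ((IsCMField.complexConj F) • w).asIdeal w.asIdeal xσ
      (AlgPoints.map (S.M.map (homOfLE hN'Kc)) xC) (AlgPoints.map (recordHeckeTranslateGS S hU7ₛ (rc₁ β) N' Kc (hrcN₁ β)) xC)
      (AlgPoints.map (S.M.map (homOfLE hN'Kc)) x') (AlgPoints.map (recordHeckeTranslateGS S hU7ₛ (rc₁ β) N' Kc (hrcN₁ β)) x') h₀
      (hℓ _ (recordHeckeTranslateGS S hU7ₛ (rc₁ β) N' Kc (hrcN₁ β))) Φ hΦ (htors _) (Hβ β) Kβ hK.1 hK.2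
  · exact (hr₂ β₂).elim fun K₂ hK =>
      centralRoofAt_transport S Kc ((sigmaHom ι₁ τE hτE w σ e' hσe).comp e') e' univ act dual pol lvl pChar
      ((IsCMField.complexConj F) • w).asIdeal w.asIdeal xσ
      (AlgPoints.map (S.M.map (homOfLE hN'Kc)) xC) (AlgPoints.map (recordHeckeTranslateGS S hU7ₛ (rc₂ β₂) N' Kc (hrcN₂ β₂)) xC)
      (AlgPoints.map (S.M.map (homOfLE hN'Kc)) x') (AlgPoints.map (recordHeckeTranslateGS S hU7ₛ (rc₂ β₂) N' Kc (hrcN₂ β₂)) x') h₀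
      (hℓ _ (recordHeckeTranslateGS S hU7ₛ (rc₂ β₂) N' Kc (hrcN₂ β₂))) Φ hΦ (htors _) K₂ hK.1 hK.2

/-! ### §2c ORGAN (O-MP) — THE MARKED PAIR OF A HECKE TRANSLATE (the one typed organ BOTH roof assemblers (O-R1)∕(O-R2) and the hom-family organ (O-HF) consume) -/

end Summit.HodgeConjecture.HodgeConjecture.Cruxes.HLiu418.F0P6aStubEHECKE
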